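import Literature.AlgebraicGeometry.AbelianSchemes.PolarizationSymmetricWitnessOfOnto
import Literature.AlgebraicGeometry.Motives.CartierDivisorAmpleOfSmul
import HarnessLib

/-!
# An ample class twisted by a `Pic⁰` class is ample (Mumford §8 Thm. 1 ⇒ `Θ + Z ∼ t_a^*Θ`), and the `q • M` step

Layer `Literature/AlgebraicGeometry/AbelianVarieties`, namespace `Literature.AlgebraicGeometry.AbelianSchemes.AbelianSchemeOver`
(§2–§3) and `Literature.AlgebraicGeometry.Motives.AbelianVariety` (§1, §4).
THEOREMS ONLY (no definition, no named fact, no instance, no `sorry`).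

Setting (§2–§3): an abelian scheme `A/S` with a dual pair `D = (Â, 𝒫)`, an `S`-morphism `λ : A → Â`, a geometric point
`s : Spec Ω → S` (`Ω` algebraically closed), the fibre abelian variety `X := A_s`, Cartier divisors on `X` with the tree's
`IsAmple` ([GortzWedhorn2020] Prop. 13.47 (iv)), linear equivalence `∼`, the Weil divisors `D_a(Θ) = t_a^*Θ − Θ` (★ `weilDiv`)
and the witness relation `λ̄ = Λ(𝒪(Θ))` on points (★ `IsLambdaOfAt`, [MumfordFogartyKirwan1994] Def. 6.2–6.3).  A class `[Z]`
lies in `Pic⁰(X)` in the sense of [MumfordAV1970] §8 (i) when it is translation-invariant, `t_P^*Z ∼ Z` for all `P ∈ X(Ω)`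
(equivalently `𝒪(Z)` is homogeneous, ★ `isHomogeneous_lineBundle_iff_forall_linEquiv`).

* §1 `AbelianVariety.pullback_translation_linEquiv_add_of_linEquiv_weilDiv` — bookkeeping over any field: `Z ∼ D_a(Θ)` gives
  `t_a^*Θ ∼ Θ + Z`; hence `AbelianVariety.isAmple_add_of_linEquiv_weilDiv`: `Θ` ample ⇒ `Θ + Z` ample (a translate of an ample
  divisor is ample, ★ `IsAmple.pullback`; ampleness is a class invariant, ★ `LinEquiv.isAmple`).
* §2 **`IsLambdaOfAt.isAmple_add_of_forall_translation_linEquiv`** — AMPLE ⊗ `Pic⁰` IS AMPLE at a geometric point: for an ample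
  witness `Θ` of `λ̄` at `s` with `λ̄_s` onto on `Ω`-points (`hsurj`, ★ `Polarization.exists_comp_lam_eq_of_dim_hat` /
  `…_of_locallyOfFiniteType`) and `Z` translation-invariant, `Θ + Z` is ample — [MumfordAV1970] §8 Thm. 1 at `s` (★
  `exists_linEquiv_weilDiv_of_onto`: `Z ∼ D_a(Θ)`) and §1; `…_of_isHomogeneous` — the same with `Pic⁰` spelled `IsHomogeneous`.
* §3 **`IsLambdaOfAt.isAmple_of_linEquiv_smul_add`** — the step used by the `n = 2` road of the (V)-upgrade: if the ample witness
  `Θ` satisfies `Θ ∼ q • M + N` with `N` translation-invariant and `0 < q`, then `M` is ample (`Θ + (−N) ∼ q • M` is ample by §2,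
  and ★ `IsAmple.of_smul`, [GortzWedhorn2020] Prop. 13.50 (1)); `…_of_isHomogeneous` likewise.
* §4 `AbelianVariety.isAmple_add_of_forall_translation_linEquiv_complex` — over `ℂ`, binder-free, for a bare complex abelian
  variety (★ Mumford §8 Thm. 1 over `ℂ`, `exists_linEquiv_weilDiv_of_forall_translate_linEquiv`), and the `q • M` step there.

Purpose (cell `hodgecm-mathlib`, D-0151; F-6 (V)-upgrade leaf, `n = 2` road, second hand to B-p03 (g17); B-plan1 (g16)
07:46:07Z / 07:49:59Z): the two field-level ampleness clauses «ample + `Pic⁰` is ample» (this file) and «`M` ample ⇔ `2 • M`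
ample» (★ `CartierDivisor.isAmple_smul_iff`).  Count-neutral; HC_CM is proved only modulo the 7 printed citations until rung 0
closes.

## References
* [MumfordAV1970] D. Mumford, *Abelian Varieties* (1970), §8 (i)–(iv) (pp. 74–75) and §8 Thm. 1 (p. 77); §6 Application 1
  (p. 60).
* [MumfordFogartyKirwan1994] D. Mumford, J. Fogarty, F. Kirwan, *Geometric Invariant Theory*, 3rd ed. (1994), Ch. 6 §2
  Def. 6.2–6.3 (p. 120).
* [GortzWedhorn2020] U. Görtz, T. Wedhorn, *Algebraic Geometry I* (2nd ed., 2020), Prop. 13.47 (iv) (p. 392), Prop. 13.50 (1) (p. 394),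
  Prop. 13.66 (2) (p. 402).
-/

set_option autoImplicit false

noncomputable section

universe u

open CategoryTheory CategoryTheory.Limits AlgebraicGeometry MonoidalCategory
open scoped MonObj

/-! ## §1 Bookkeeping over any field: `Z ∼ D_a(Θ)` gives `t_a^*Θ ∼ Θ + Z` -/

namespace Literature.AlgebraicGeometry.Motives.AbelianVariety

open Literature.AlgebraicGeometry.AbelianSchemes Literature.AlgebraicGeometry.AbelianVarieties
  Literature.AlgebraicGeometry.Modules

variable {K : Type u} [Field K] (X : AbelianVariety K)

/-- If `Z ∼ D_a(Θ) = t_a^*Θ − Θ` then `t_a^*Θ ∼ Θ + Z` (classes in `Ȟ¹(X, 𝒪^×)`: `t_a^*[Θ] = [Θ]·(t_a^*[Θ]·[Θ]⁻¹)`).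
[cite: MumfordAV1970, §8 (pp. 74–75)] -/
theorem pullback_translation_linEquiv_add_of_linEquiv_weilDiv (Θ Z : CartierDivisor X.X.left) (a : X.Points K)
    (h : Z.LinEquiv (X.weilDiv Θ a)) : (Θ.pullback (X.translation a).left).LinEquiv (Θ + Z) := by
  rw [← CartierDivisor.cechClass_eq_iff_linEquiv] at h ⊢
  rw [CartierDivisor.cechClass_add, h, AbelianSchemeOver.cechClass_weilDiv, CartierDivisor.cechClass_pullback,
    mul_left_comm, mul_inv_cancel, mul_one]

/-- **A translate of an ample divisor twisted back: `Θ` ample and `Z ∼ D_a(Θ)` ⇒ `Θ + Z` ample** (`Θ + Z ∼ t_a^*Θ`, and the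
translate `t_a^*Θ` of an ample divisor is ample, ★ `IsAmple.pullback`; ampleness is a class invariant, ★ `LinEquiv.isAmple`).
[cite: MumfordAV1970, §6 Application 1 (p. 60) and §8 (pp. 74–75)] [cite: GortzWedhorn2020, Prop. 13.66 (2) (p. 402)] -/
theorem isAmple_add_of_linEquiv_weilDiv {Θ : CartierDivisor X.X.left} (hamp : Θ.IsAmple) {Z : CartierDivisor X.X.left}
    {a : X.Points K} (h : Z.LinEquiv (X.weilDiv Θ a)) : (Θ + Z).IsAmple :=
  (X.pullback_translation_linEquiv_add_of_linEquiv_weilDiv Θ Z a h).isAmple (hamp.pullback _)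

/-- `Θ ∼ q • M + N` gives `Θ + (−N) ∼ q • M`. [folklore] -/
private theorem add_neg_linEquiv_smul_of_linEquiv_smul_add {Θ M N : CartierDivisor X.X.left} {q : ℕ}
    (hlin : Θ.LinEquiv (q • M + N)) : (Θ + -N).LinEquiv (q • M) := by
  rw [← CartierDivisor.cechClass_eq_iff_linEquiv] at hlin ⊢
  rw [CartierDivisor.cechClass_add, hlin, CartierDivisor.cechClass_add, AbelianSchemeOver.cechClass_neg_eq_inv',
    mul_inv_cancel_right]

/-- Translation-invariance passes to `−N`: `t_P^*(−N) ∼ −N`. [folklore] -/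
private theorem pullback_translation_neg_linEquiv_of_forall {N : CartierDivisor X.X.left}
    (hN : ∀ P : X.Points K, (N.pullback (X.translation P).left).LinEquiv N) (P : X.Points K) :
    ((-N).pullback (X.translation P).left).LinEquiv (-N) :=
  (CartierDivisor.pullback_neg_sameDivisor (X.translation P).left N).linEquiv.trans (hN P).neg

end Literature.AlgebraicGeometry.Motives.AbelianVariety

namespace Literature.AlgebraicGeometry.AbelianSchemes

open Literature.AlgebraicGeometry.Motives Literature.AlgebraicGeometry.AbelianVarieties Literature.AlgebraicGeometry.Modules

namespace AbelianSchemeOver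

variable {S : Scheme.{u}} (A : AbelianSchemeOver S) (D : A.DualPair) {Ω : Type u} [Field Ω] [IsAlgClosed Ω]
  (s : Spec (.of Ω) ⟶ S)

/-! ## §2 Ample ⊗ `Pic⁰` is ample at a geometric point -/

/-- **AMPLE ⊗ `Pic⁰` IS AMPLE, at a geometric point**: let `Θ` be an AMPLE witness of `λ̄` at `s` (`λ̄ = Λ(𝒪(Θ))`, `Ω`
algebraically closed) with `λ̄_s` onto on `Ω`-points (`hsurj`), and let `Z` be translation-invariant (`t_P^*Z ∼ Z` for all
`P ∈ A_s(Ω)`, i.e. `[Z] ∈ Pic⁰(A_s)`).  Then `Θ + Z` is ample: by [MumfordAV1970] §8 Thm. 1 at `s` (★ `exists_linEquiv_weilDiv_of_onto`)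
`Z ∼ D_a(Θ) = t_a^*Θ − Θ` for some `a`, so `Θ + Z ∼ t_a^*Θ`, a translate of an ample divisor.
[cite: MumfordAV1970, §8 Thm. 1 (p. 77) and §6 Application 1 (p. 60)] [cite: MumfordFogartyKirwan1994, Ch. 6 §2 Definition 6.2–6.3 (p. 120)] -/
theorem IsLambdaOfAt.isAmple_add_of_forall_translation_linEquiv (lam : A.X ⟶ D.hat.X)
    {Θ : CartierDivisor (A.fibre s).toAbelianVariety.X.left} (hΘ : A.IsLambdaOfAt s D lam Θ) (hamp : Θ.IsAmple)
    (hsurj : ∀ y : D.hat.FibrePoints s, ∃ x : A.FibrePoints s, x ≫ lam = y)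
    (Z : CartierDivisor (A.fibre s).toAbelianVariety.X.left)
    (hZ : ∀ P : (A.fibre s).toAbelianVariety.Points Ω,
      (Z.pullback ((A.fibre s).toAbelianVariety.translation P).left).LinEquiv Z) :
    (Θ + Z).IsAmple := by
  obtain ⟨a, ha⟩ := exists_linEquiv_weilDiv_of_onto A D s lam hΘ hsurj Z hZ
  exact (A.fibre s).toAbelianVariety.isAmple_add_of_linEquiv_weilDiv hamp ha

/-- **AMPLE ⊗ `Pic⁰` IS AMPLE, `Pic⁰` spelled `IsHomogeneous`** ([MumfordAV1970] §8: `𝒪(Z)` homogeneous, i.e. `t_P^*𝒪(Z) ≅ 𝒪(Z)`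
for all `P`; ★ `isHomogeneous_lineBundle_iff_forall_linEquiv`). [cite: MumfordAV1970, §8 Thm. 1 (p. 77) and §8 (i) (p. 74)] -/
theorem IsLambdaOfAt.isAmple_add_of_isHomogeneous (lam : A.X ⟶ D.hat.X)
    {Θ : CartierDivisor (A.fibre s).toAbelianVariety.X.left} (hΘ : A.IsLambdaOfAt s D lam Θ) (hamp : Θ.IsAmple)
    (hsurj : ∀ y : D.hat.FibrePoints s, ∃ x : A.FibrePoints s, x ≫ lam = y)
    (Z : CartierDivisor (A.fibre s).toAbelianVariety.X.left)
    (hZ : IsHomogeneous (A.fibre s).toAbelianVariety (lineBundle Z.toUnitCocycle)) :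
    (Θ + Z).IsAmple :=
  hΘ.isAmple_add_of_forall_translation_linEquiv A D s lam hamp hsurj Z
    ((isHomogeneous_lineBundle_iff_forall_linEquiv (A.fibre s).toAbelianVariety Z).1 hZ)

/-! ## §3 The `q • M` step: `Θ ∼ q • M + N`, `Θ` an ample witness, `N ∈ Pic⁰` ⇒ `M` ample -/

/-- **THE `q • M` STEP**: let `Θ` be an ample witness of `λ̄` at `s` with `λ̄_s` onto on `Ω`-points, `N` translation-invariant
(`[N] ∈ Pic⁰`), `0 < q`, and `Θ ∼ q • M + N`.  Then `M` is ample: `−N` is translation-invariant, so `Θ + (−N) ∼ q • M` is ample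
(§2), and `q • M` ample ⇒ `M` ample ([GortzWedhorn2020] Prop. 13.50 (1), ★ `IsAmple.of_smul`).  (On the `n = 2` road of the
(V)-upgrade: `Θ = L′`, `Λ(L′) = 2m`, `L′ ∼ 2 • M + ((−1)^*L₁ − L₁)`.)
[cite: MumfordAV1970, §8 Thm. 1 (p. 77)] [cite: GortzWedhorn2020, Prop. 13.50 (1) (p. 394)] -/
theorem IsLambdaOfAt.isAmple_of_linEquiv_smul_add (lam : A.X ⟶ D.hat.X)
    {Θ : CartierDivisor (A.fibre s).toAbelianVariety.X.left} (hΘ : A.IsLambdaOfAt s D lam Θ) (hamp : Θ.IsAmple)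
    (hsurj : ∀ y : D.hat.FibrePoints s, ∃ x : A.FibrePoints s, x ≫ lam = y)
    {M N : CartierDivisor (A.fibre s).toAbelianVariety.X.left}
    (hN : ∀ P : (A.fibre s).toAbelianVariety.Points Ω,
      (N.pullback ((A.fibre s).toAbelianVariety.translation P).left).LinEquiv N)
    {q : ℕ} (hq : 0 < q) (hlin : Θ.LinEquiv (q • M + N)) : M.IsAmple :=
  CartierDivisor.IsAmple.of_smul hq
    (((A.fibre s).toAbelianVariety.add_neg_linEquiv_smul_of_linEquiv_smul_add hlin).isAmple
      (hΘ.isAmple_add_of_forall_translation_linEquiv A D s lam hamp hsurj (-N)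
        ((A.fibre s).toAbelianVariety.pullback_translation_neg_linEquiv_of_forall hN)))

/-- **THE `q • M` STEP, `Pic⁰` spelled `IsHomogeneous`.** [cite: MumfordAV1970, §8 Thm. 1 (p. 77)] [cite: GortzWedhorn2020, Prop. 13.50 (1) (p. 394)] -/
theorem IsLambdaOfAt.isAmple_of_linEquiv_smul_add_of_isHomogeneous (lam : A.X ⟶ D.hat.X)
    {Θ : CartierDivisor (A.fibre s).toAbelianVariety.X.left} (hΘ : A.IsLambdaOfAt s D lam Θ) (hamp : Θ.IsAmple)
    (hsurj : ∀ y : D.hat.FibrePoints s, ∃ x : A.FibrePoints s, x ≫ lam = y)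
    {M N : CartierDivisor (A.fibre s).toAbelianVariety.X.left}
    (hN : IsHomogeneous (A.fibre s).toAbelianVariety (lineBundle N.toUnitCocycle))
    {q : ℕ} (hq : 0 < q) (hlin : Θ.LinEquiv (q • M + N)) : M.IsAmple :=
  hΘ.isAmple_of_linEquiv_smul_add A D s lam hamp hsurj
    ((isHomogeneous_lineBundle_iff_forall_linEquiv (A.fibre s).toAbelianVariety N).1 hN) hq hlin

end AbelianSchemeOver

end Literature.AlgebraicGeometry.AbelianSchemes

/-! ## §4 Over `ℂ`, binder-free -/

namespace Literature.AlgebraicGeometry.Motives.AbelianVariety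

open Literature.AlgebraicGeometry.AbelianSchemes Literature.AlgebraicGeometry.AbelianVarieties
  Literature.AlgebraicGeometry.Modules

/-- **AMPLE ⊗ `Pic⁰` IS AMPLE on a complex abelian variety**, binder-free: `Θ` ample and `Z` translation-invariant ⇒ `Θ + Z`
ample ([MumfordAV1970] §8 Thm. 1 over `ℂ`, ★ `exists_linEquiv_weilDiv_of_forall_translate_linEquiv`, and §1).
[cite: MumfordAV1970, §8 Thm. 1 (p. 77) and §6 Application 1 (p. 60)] -/
theorem isAmple_add_of_forall_translation_linEquiv_complex (X : AbelianVariety ℂ) {Θ : CartierDivisor X.X.left}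
    (hamp : Θ.IsAmple) (Z : CartierDivisor X.X.left)
    (hZ : ∀ P : X.Points ℂ, (Z.pullback (X.translation P).left).LinEquiv Z) : (Θ + Z).IsAmple := by
  obtain ⟨a, ha⟩ := X.exists_linEquiv_weilDiv_of_forall_translate_linEquiv hamp Z hZ
  exact X.isAmple_add_of_linEquiv_weilDiv hamp ha

/-- **THE `q • M` STEP on a complex abelian variety**, binder-free: `Θ` ample, `N` translation-invariant, `0 < q`,
`Θ ∼ q • M + N` ⇒ `M` ample. [cite: MumfordAV1970, §8 Thm. 1 (p. 77)] [cite: GortzWedhorn2020, Prop. 13.50 (1) (p. 394)] -/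
theorem isAmple_of_linEquiv_smul_add_complex (X : AbelianVariety ℂ) {Θ : CartierDivisor X.X.left} (hamp : Θ.IsAmple)
    {M N : CartierDivisor X.X.left} (hN : ∀ P : X.Points ℂ, (N.pullback (X.translation P).left).LinEquiv N)
    {q : ℕ} (hq : 0 < q) (hlin : Θ.LinEquiv (q • M + N)) : M.IsAmple :=
  CartierDivisor.IsAmple.of_smul hq
    ((X.add_neg_linEquiv_smul_of_linEquiv_smul_add hlin).isAmple
      (X.isAmple_add_of_forall_translation_linEquiv_complex hamp (-N) (X.pullback_translation_neg_linEquiv_of_forall hN)))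

end Literature.AlgebraicGeometry.Motives.AbelianVariety

end
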